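import Literature.AlgebraicTopology.CharacteristicClasses.LineEulerClass
import Literature.AlgebraicTopology.CharacteristicClasses.ProjectiveCompletionParts
import Literature.AlgebraicTopology.CharacteristicClasses.ProjectiveDeformation
import Literature.AlgebraicTopology.SingularHomology.RelativeCochainsMaps
import Literature.AlgebraicTopology.SingularHomology.CohomologyHomotopyInvariance
import Literature.AlgebraicTopology.CharacteristicClasses.VectorBundleZeroSection
import Literature.AlgebraicTopology.SingularHomology.RelativeKroneckerAbsolute
import Literature.AlgebraicTopology.SingularHomology.LocalisationAdditivity
import Literature.AlgebraicTopology.SingularHomology.LocalHomologyVanishing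
import Literature.AlgebraicTopology.SingularHomology.FundamentalClassExistence
import HarnessLib

/-!
# The Euler number of a complex line bundle over a closed oriented surface is the sum of the local
# indices of a section at its zeros

D. McDuff, D. Salamon, *Introduction to Symplectic Topology*, 3rd ed. (2017), §2.7, Thm. 2.7.5 (for a
complex line bundle over a closed oriented surface "the first Chern number `c₁(E)` agrees with the
number of zeros of a generic section, counted with multiplicities" — the zeros counted by their local
indices); R. Bott, L. Tu, *Differential Forms in Algebraic Topology* (1982), Thm. 11.17 (the Euler
class is Poincaré dual to the zero locus of a transverse section, the sum of the local degrees);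
J. Milnor, J. Stasheff, *Characteristic Classes* (1974), §9–§10 (the Thom class `u ∈ Hⁿ(E, E₀)` and
the Euler class `e = s₀^* u|_E`) with A. Hatcher, *Algebraic Topology* (2002), Lemma 3.27 / Prop. 2.30
(a class of `Hₙ(M | K)`, `K` finite, is the sum of its local pieces).

For the tree's Euler class `eulerClass F E hF R m = s₀^* t(m) ∈ H²(B; R)` of a complex LINE bundle
`λ = (F, E)` (`LineEulerClass`: `t(m)` THE Thom class on the projective completion `D = P(λ ⊕ ℂ)`,
normalised by the Mayer–Vietoris generator `ω` of the fibre `ℂP¹`) this file proves the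
**localisation theorem**

  `⟨e(λ)(m), [S]_μ⟩ = Σ_{p ∈ Z(s)} ind_p(s)`   (`kroneckerPairing_eulerClass_fundamentalClass`)

for every closed surface `S` (compact Hausdorff, charts `ℝ²`), every `R`-orientation `μ` of `S`
(`HomologicalOrientation`, fundamental class `[S]_μ`), and every continuous section `s` of `λ` with
finite zero set `Z(s)`, where the LOCAL INDEX `ind_p(s) ∈ R` (`localIndex`) is the relative Kronecker
pairing `⟨(ŝ|_{U_p})^* t̃, μ_p⟩` of the pull-back of the RELATIVE Thom class
`t̃ ∈ H²(D, D ∖ s₀(B); R)` along the projectivised section `ŝ = [s : 1] : (U_p, U_p ∖ p) → (D, D ∖ s₀(B))`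
on the index domain `U_p = {p} ∪ {s ≠ 0}` with the local orientation `μ_p ∈ H₂(S | p)` (excised to
`U_p`).  The ingredients, all proved here:

* `lineScale`, `vectorPartHomotopy` — the fibrewise deformation `[v : z] ↦ [v : (1 - t) z]` of the
  vector part `D ∖ s₀(B) = {[v : z] | v ≠ 0}` onto the section at infinity (continuity read in the
  local product structures `complTriv`, where it is the projective linear deformation
  `projDeformation` of `(w, z) ↦ (w, 0)`); hence `t|_{D ∖ s₀(B)} = 0`
  (`map_subsetIncl_vectorPart_thomClass`, as `s_∞^* t = 0`), restriction `Hⁿ(D) → Hⁿ(D ∖ s₀(B))` is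
  onto and `Hⁿ⁺¹(D, D ∖ s₀(B)) → Hⁿ⁺¹(D)` is one-to-one (`toAbsolute_vectorPart_injective`);
* `relThomClass` — **the relative Thom class** `t̃(m) ∈ H²(D, D ∖ s₀(B); R)`, the UNIQUE lift of
  `t(m)` (`toAbsolute_relThomClass`, `eq_relThomClass_of_toAbsolute_eq`; Milnor–Stasheff's
  `u ∈ H(E, E₀)` in the projective-completion model);
* `projSection`, `projSectionHomotopy`, `eulerClass_eq_map_projSection` — `ŝ = [s : 1] ≃ s₀` by
  `[t s : 1]`, so `e(λ) = ŝ^* t` for every section, and `ŝ` maps `S ∖ Z(s)` into `D ∖ s₀(B)`;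
* `localIndex`, `localIndex_eq_of_subset` — the local index and its locality (computable on any open
  `V ∋ p` inside `U_p`; excision);
* the theorem: `⟨e, [S]⟩ = ⟨j^*(ŝ^* t̃), [S]⟩ = ⟨ŝ^* t̃, j_*[S]⟩` (`kroneckerPairing_toAbsolute`) and
  `j_*[S] ∈ H₂(S | Z)` is the sum over `p ∈ Z` of the local orientations pushed in from the index
  domains (`localHomologyOfSet.eq_sum_of_forall_map_eq_restrictLocal`, `[S]` restricting to `μ_p`),
  each term being `ind_p(s)` by naturality of the relative Kronecker pairing.

The identification of `ind_p(s)` with the local degree of `s` read in a trivialisation (`±1` for a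
transverse zero) is the sequel.  Everything is proved; no named facts.

## References

* [McDuffSalamon2017] D. McDuff, D. Salamon, Introduction to Symplectic Topology, 3rd ed., OUP 2017,
  §2.7 Thm. 2.7.5.
* [BottTu1982] R. Bott, L. W. Tu, Differential Forms in Algebraic Topology, GTM 82, Springer 1982,
  Thm. 11.17, Prop. 6.24, Prop. 12.8.
* [MilnorStasheff1974] J. Milnor, J. Stasheff, Characteristic Classes, PUP 1974, §9, §10 Thm. 10.4.
* [HatcherAT2002] A. Hatcher, Algebraic Topology, CUP 2002, Ch. 0 Example 0.6, Thm. 2.20, Prop. 2.30,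
  §3.1 pp. 199–201, Lemma 3.27.
-/

noncomputable section

open CategoryTheory Function Set Bundle Topology unitInterval Literature.AlgebraicTopology.SingularHomology
open scoped LinearAlgebra.Projectivization

universe u

namespace Literature.AlgebraicTopology.CharacteristicClasses


/-! ### Scaling the `ℂ`-coordinate of a point of `ℙ(V ⊕ ℂ)` off the origin -/

section LineScale

variable {V : Type*} [AddCommGroup V] [Module ℂ V]

/-- A point of `ℙ(V ⊕ ℂ)` other than the origin `[0 : 1]` has a representative with non-zero
`V`-component. [folklore] -/
theorem rep_fst_ne_zero {ℓ : ℙ ℂ (V × ℂ)} (h : ℓ ≠ zeroPt V) : ℓ.rep.1 ≠ 0 := by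
  intro h0
  apply h
  have h2 : ℓ.rep.2 ≠ 0 := fun h2 ↦ ℓ.rep_nonzero (Prod.ext h0 h2)
  rw [← ℓ.mk_rep, zeroPt, Projectivization.mk_eq_mk_iff']
  exact ⟨ℓ.rep.2, Prod.ext (by rw [Prod.smul_fst, smul_zero, h0]) (by rw [Prod.smul_snd, smul_eq_mul, mul_one])⟩

omit [Module ℂ V] in
/-- `(v, c z) ≠ 0` for `v ≠ 0`. [folklore] -/
theorem pair_ne_zero_of_fst_ne_zero {v : V} (hv : v ≠ 0) (z : ℂ) : ((v, z) : V × ℂ) ≠ 0 :=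
  fun h ↦ hv (Prod.mk_eq_zero.1 h).1

/-- **Scaling the `ℂ`-coordinate**: `[v : z] ↦ [v : c z]` off the origin (and the identity at the
origin).  For `c = 1 - t`, `t ∈ [0, 1]`, this deforms `ℙ(V ⊕ ℂ) ∖ [0 : 1]` onto the point at
infinity `[v : 0]`. [cite: HatcherAT2002, Ch. 0 Example 0.6] -/
def lineScale (c : ℂ) (ℓ : ℙ ℂ (V × ℂ)) : ℙ ℂ (V × ℂ) := by
  classical
  exact if h : ℓ = zeroPt V then ℓ
    else Projectivization.mk ℂ (ℓ.rep.1, c * ℓ.rep.2) (pair_ne_zero_of_fst_ne_zero (rep_fst_ne_zero h) _)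

/-- `lineScale c [v : z] = [v : c z]` for `v ≠ 0`. [folklore] -/
theorem lineScale_mk (c : ℂ) {v : V} (hv : v ≠ 0) (z : ℂ) (h : ((v, z) : V × ℂ) ≠ 0) :
    lineScale c (Projectivization.mk ℂ (v, z) h) =
      Projectivization.mk ℂ (v, c * z) (pair_ne_zero_of_fst_ne_zero hv _) := by
  have hne : Projectivization.mk ℂ (v, z) h ≠ zeroPt V := fun h' ↦ hv ((mk_eq_zeroPt_iff v z h).1 h')
  rw [lineScale, dif_neg hne]
  obtain ⟨a, ha⟩ := Projectivization.exists_smul_eq_mk_rep ℂ (v, z) h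
  rw [Projectivization.mk_eq_mk_iff]
  refine ⟨a, ?_⟩
  rw [← ha]
  ext
  · rfl
  · change a • (c * z) = c * (a • (v, z)).2
    rw [Prod.smul_snd, Units.smul_def, Units.smul_def, smul_eq_mul, smul_eq_mul]
    ring

/-- `lineScale 1 = 𝟙`. [folklore] -/
theorem lineScale_one (ℓ : ℙ ℂ (V × ℂ)) : lineScale 1 ℓ = ℓ := by
  by_cases h : ℓ = zeroPt V
  · rw [lineScale, dif_pos h]
  · induction ℓ using Projectivization.ind with
    | h w hw =>
      obtain ⟨v, z⟩ := w
      have hv : v ≠ 0 := fun hv ↦ h ((mk_eq_zeroPt_iff v z hw).2 hv)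
      rw [lineScale_mk 1 hv z hw]
      congr 1
      rw [one_mul]

/-- `lineScale 0 [v : z] = [v : 0]`, the point at infinity. [folklore] -/
theorem lineScale_zero_mk {v : V} (hv : v ≠ 0) (z : ℂ) (h : ((v, z) : V × ℂ) ≠ 0) :
    lineScale 0 (Projectivization.mk ℂ (v, z) h) = infPt v hv := by
  rw [lineScale_mk 0 hv z h, infPt]
  congr 1
  rw [zero_mul]

/-- **Naturality of the scaling under `A × 𝟙`** for an injective linear `A`. [folklore] -/
theorem map_prodMap_lineScale {W : Type*} [AddCommGroup W] [Module ℂ W] (A : V →ₗ[ℂ] W) (hA : Injective A)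
    (c : ℂ) {v : V} (hv : v ≠ 0) (z : ℂ) (h : ((v, z) : V × ℂ) ≠ 0) :
    Projectivization.map (A.prodMap (LinearMap.id : ℂ →ₗ[ℂ] ℂ)) (hA.prodMap injective_id)
        (lineScale c (Projectivization.mk ℂ (v, z) h)) =
      lineScale c (Projectivization.map (A.prodMap (LinearMap.id : ℂ →ₗ[ℂ] ℂ)) (hA.prodMap injective_id)
        (Projectivization.mk ℂ (v, z) h)) := by
  have hAv : A v ≠ 0 := fun h0 ↦ hv (hA (by rw [h0, map_zero]))
  rw [lineScale_mk c hv z h, Projectivization.map_mk, Projectivization.map_mk]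
  change Projectivization.mk ℂ (A v, c * z) _ = lineScale c (Projectivization.mk ℂ (A v, z) _)
  rw [lineScale_mk c hAv]

end LineScale

/-! ### The scaling on the model `ℙ(F ⊕ ℂ)` is a continuous deformation off the origin -/

section Model

variable (F : Type u) [NormedAddCommGroup F] [NormedSpace ℂ F]

/-- The projection `(w, z) ↦ (w, 0)` of `F ⊕ ℂ` onto `F ⊕ 0`. [folklore] -/
def fstProj : F × ℂ →L[ℂ] F × ℂ := (ContinuousLinearMap.inl ℂ F ℂ).comp (ContinuousLinearMap.fst ℂ F ℂ)

/-- `fstProj (w, z) = (w, 0)`. [folklore] -/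
@[simp] theorem fstProj_apply (w : F × ℂ) : fstProj F w = (w.1, 0) := rfl

/-- `fstProj` is idempotent. [folklore] -/
theorem fstProj_idem (w : F × ℂ) : fstProj F (fstProj F w) = fstProj F w := rfl

/-- The chart `{[w : z] | w ≠ 0}` of `fstProj` is the complement of the origin. [folklore] -/
theorem mem_projChart_fstProj_iff (ℓ : ℙ ℂ (F × ℂ)) : ℓ ∈ projChart (fstProj F) ↔ ℓ ≠ zeroPt F := by
  induction ℓ using Projectivization.ind with
  | h w hw =>
    obtain ⟨v, z⟩ := w
    simp only [mk_mem_projChart_iff, fstProj_apply, ne_eq, Prod.mk_eq_zero, and_true, mk_eq_zeroPt_iff v z hw]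

/-- The linear deformation of `fstProj` at time `t` is the scaling by `1 - t`:
`(1 - t)(w, z) + t (w, 0) = (w, (1 - t) z)`. [folklore] -/
theorem deformVec_fstProj (t : ℝ) (w : F × ℂ) :
    deformVec (fstProj F) t w = (w.1, ((1 - t : ℝ) : ℂ) * w.2) := by
  obtain ⟨v, z⟩ := w
  rw [deformVec, fstProj_apply]
  ext
  · change ((1 - t : ℝ) : ℂ) • v + ((t : ℝ) : ℂ) • v = v
    rw [← add_smul, ← Complex.ofReal_add, sub_add_cancel, Complex.ofReal_one, one_smul]
  · change ((1 - t : ℝ) : ℂ) • z + ((t : ℝ) : ℂ) • (0 : ℂ) = ((1 - t : ℝ) : ℂ) * z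
    rw [smul_zero, add_zero, smul_eq_mul]

/-- **The deformation of `fstProj` IS the scaling**: on `{[w : z] | w ≠ 0}`,
`projDeformation (fstProj) ([w : z], t) = lineScale (1 - t) [w : z]`. [folklore] -/
theorem projDeformation_fstProj_eq (p : ↥(projChart (fstProj F))) (t : I) :
    (projDeformation (fstProj F) (fstProj_idem F) (p, t) : ℙ ℂ (F × ℂ)) = lineScale ((1 - (t : ℝ) : ℝ) : ℂ) p.1 := by
  obtain ⟨ℓ, hℓ⟩ := p
  induction ℓ using Projectivization.ind with
  | h w hw =>
    obtain ⟨v, z⟩ := w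
    have hv : v ≠ 0 := fun hv ↦ ((mem_projChart_fstProj_iff F _).1 hℓ) ((mk_eq_zeroPt_iff v z hw).2 hv)
    rw [projDeformation_apply_mk (fstProj F) (fstProj_idem F) hw hℓ t]
    change Projectivization.mk ℂ (deformVec (fstProj F) t (v, z)) _ = lineScale _ (Projectivization.mk ℂ (v, z) hw)
    rw [lineScale_mk _ hv z hw]
    congr 1
    exact deformVec_fstProj F t (v, z)

/-- **The scaling `(t, ℓ) ↦ lineScale (1 - t) ℓ` is continuous on `[0, 1] × (ℙ(F ⊕ ℂ) ∖ [0 : 1])`.** [folklore] -/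
theorem continuousOn_lineScale :
    ContinuousOn (fun q : I × ℙ ℂ (F × ℂ) ↦ lineScale ((1 - (q.1 : ℝ) : ℝ) : ℂ) q.2)
      ((Prod.snd : I × ℙ ℂ (F × ℂ) → ℙ ℂ (F × ℂ)) ⁻¹' {ℓ | ℓ ≠ zeroPt F}) := by
  rw [continuousOn_iff_continuous_restrict]
  set S : Set (I × ℙ ℂ (F × ℂ)) := (Prod.snd : I × ℙ ℂ (F × ℂ) → ℙ ℂ (F × ℂ)) ⁻¹' {ℓ | ℓ ≠ zeroPt F} with hS
  have hmem : ∀ q : ↥S, q.1.2 ∈ projChart (fstProj F) :=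
    fun q ↦ (mem_projChart_fstProj_iff F _).2 q.2
  have hc : Continuous fun q : ↥S ↦
      (projDeformation (fstProj F) (fstProj_idem F) (⟨q.1.2, hmem q⟩, q.1.1) : ℙ ℂ (F × ℂ)) :=
    continuous_subtype_val.comp ((projDeformation (fstProj F) (fstProj_idem F)).continuous.comp
      (((continuous_snd.comp continuous_subtype_val).subtype_mk _).prodMk (continuous_fst.comp continuous_subtype_val)))
  convert hc using 1
  funext q
  exact (projDeformation_fstProj_eq F ⟨q.1.2, hmem q⟩ q.1.1).symm

end Model

/-! ### The fibrewise scaling on the vector part of `P(λ ⊕ ℂ)` -/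

section VectorPart

variable {B : Type u} [TopologicalSpace B] (F : Type u) [NormedAddCommGroup F] [NormedSpace ℂ F] [FiniteDimensional ℂ F]
  (E : B → Type u) [∀ b, AddCommGroup (E b)] [∀ b, Module ℂ (E b)]
  [TopologicalSpace (TotalSpace F E)] [∀ b, TopologicalSpace (E b)] [FiberBundle F E] [VectorBundle ℂ F E]
  (hF : Module.finrank ℂ F = 1)

/-- The fibrewise scaling `(t, ⟨b, [v : z]⟩) ↦ ⟨b, [v : (1 - t) z]⟩` on the vector part, as a bare
function. [cite: MilnorStasheff1974, §9 (E₀ retracts)] -/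
def vectorPartScaleFun (q : I × ↥(vectorPart F E)) : ProjCompl F E :=
  ⟨q.2.1.proj, lineScale ((1 - (q.1 : ℝ) : ℝ) : ℂ) q.2.1.2⟩

omit [TopologicalSpace B] [FiniteDimensional ℂ F] [TopologicalSpace (TotalSpace F E)] [∀ b, TopologicalSpace (E b)]
  [FiberBundle F E] [VectorBundle ℂ F E] in
/-- The scaling preserves the base point. [folklore] -/
@[simp] theorem vectorPartScaleFun_proj (q : I × ↥(vectorPart F E)) : (vectorPartScaleFun F E q).proj = q.2.1.proj := rfl

variable {F E}

/-- **Local form of the scaling**: in the local product structure of an atlas trivialisation `e`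
over `b ∈ U_e`, the scaling is the model scaling of the fibre coordinate. [folklore] -/
theorem complTriv_vectorPartScaleFun (e : Trivialization F (π F E)) [MemTrivializationAtlas e]
    (q : I × ↥(vectorPart F E)) (hb : q.2.1.proj ∈ e.baseSet) :
    complTriv e (vectorPartScaleFun F E q) =
      (q.2.1.proj, lineScale ((1 - (q.1 : ℝ) : ℝ) : ℂ) (complTriv e q.2.1).2) := by
  obtain ⟨t, ⟨⟨b, ℓ⟩, hp⟩⟩ := q
  change b ∈ e.baseSet at hb
  induction ℓ using Projectivization.ind with
  | h w hw =>
    obtain ⟨v, z⟩ := w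
    have hv : v ≠ 0 := (mk_mem_vectorPart_iff b v z hw).1 hp
    change complTriv e ⟨b, lineScale _ (Projectivization.mk ℂ (v, z) hw)⟩ =
      (b, lineScale _ (complTriv e ⟨b, Projectivization.mk ℂ (v, z) hw⟩).2)
    rw [lineScale_mk _ hv z hw, complTriv_apply_mk e hb, complTriv_apply_mk e hb]
    refine Prod.ext rfl ?_
    change _ = lineScale _ (Projectivization.mk ℂ (linEquivAt ℂ F E e b v, z) _)
    rw [lineScale_mk _ (fun h0 ↦ hv ((linEquivAt ℂ F E e b).injective (by rw [h0, map_zero]))) z]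

/-- In the local product structure the fibre coordinate of a point of the vector part is off the
origin. [folklore] -/
theorem complTriv_snd_ne_zeroPt (e : Trivialization F (π F E)) [MemTrivializationAtlas e]
    (p : ↥(vectorPart F E)) (hb : p.1.proj ∈ e.baseSet) : (complTriv e p.1).2 ≠ zeroPt F := by
  obtain ⟨⟨b, ℓ⟩, hp⟩ := p
  change b ∈ e.baseSet at hb
  induction ℓ using Projectivization.ind with
  | h w hw =>
    obtain ⟨v, z⟩ := w
    have hv : v ≠ 0 := (mk_mem_vectorPart_iff b v z hw).1 hp
    change (complTriv e ⟨b, Projectivization.mk ℂ (v, z) hw⟩).2 ≠ zeroPt F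
    rw [complTriv_apply_mk e hb]
    exact fun h ↦ hv ((linEquivAt ℂ F E e b).injective
      (((mk_eq_zeroPt_iff _ z _).1 h).trans (map_zero _).symm))

variable (F E)

/-- **The fibrewise scaling is continuous** (read in the local product structures, where it is
`𝟙 × lineScale`). [cite: MilnorStasheff1974, §9] -/
theorem continuous_vectorPartScaleFun : Continuous (vectorPartScaleFun F E) := by
  rw [continuous_iff_continuousAt]
  rintro ⟨t₀, p₀⟩
  set b₀ : B := p₀.1.proj with hb₀
  set e : Trivialization F (π F E) := trivializationAt F E b₀ with he
  have hb₀e : b₀ ∈ e.baseSet := mem_baseSet_trivializationAt F E b₀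
  -- the open set of parameters over the base set of `e`
  have hpc : Continuous fun q : I × ↥(vectorPart F E) ↦ q.2.1.proj :=
    (complProj F E).continuous.comp (continuous_subtype_val.comp continuous_snd)
  set W : Set (I × ↥(vectorPart F E)) := (fun q : I × ↥(vectorPart F E) ↦ q.2.1.proj) ⁻¹' e.baseSet with hW
  have hWo : IsOpen W := e.open_baseSet.preimage hpc
  have hWmem : W ∈ 𝓝 (t₀, p₀) := hWo.mem_nhds hb₀e
  have hproj : ContinuousAt (TotalSpace.proj ∘ vectorPartScaleFun F E) (t₀, p₀) := by
    have hfun : TotalSpace.proj ∘ vectorPartScaleFun F E = fun q ↦ q.2.1.proj :=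
      funext fun q ↦ vectorPartScaleFun_proj F E q
    rw [hfun]
    exact hpc.continuousAt
  refine (complTriv e).continuousAt_of_comp_left hproj
    (by rw [complTriv_baseSet, vectorPartScaleFun_proj]; exact hb₀e) ?_
  -- `complTriv e ∘ scaling = (proj, lineScale (1 - t) (fibre coordinate))` on `W`
  have hΦ : ContinuousOn (fun q : I × ↥(vectorPart F E) ↦
      (q.2.1.proj, lineScale ((1 - (q.1 : ℝ) : ℝ) : ℂ) (complTriv e q.2.1).2)) W := by
    refine hpc.continuousOn.prodMk ?_
    have h2 : ContinuousOn (fun q : I × ↥(vectorPart F E) ↦ (complTriv e q.2.1).2) W := by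
      refine continuous_snd.comp_continuousOn ((complTriv e).continuousOn.comp
        (continuous_subtype_val.comp continuous_snd).continuousOn fun q hq ↦ ?_)
      rw [(complTriv e).source_eq, complTriv_baseSet]
      exact hq
    have h1 : ContinuousOn (fun q : I × ↥(vectorPart F E) ↦ ((q.1, (complTriv e q.2.1).2) : I × ℙ ℂ (F × ℂ))) W :=
      continuous_fst.continuousOn.prodMk h2
    refine (continuousOn_lineScale F).comp h1 fun q hq ↦ ?_
    exact complTriv_snd_ne_zeroPt e q.2 hq
  have heq : ∀ q ∈ W, (complTriv e ∘ vectorPartScaleFun F E) q =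
      (q.2.1.proj, lineScale ((1 - (q.1 : ℝ) : ℝ) : ℂ) (complTriv e q.2.1).2) :=
    fun q hq ↦ complTriv_vectorPartScaleFun e q hq
  exact ((hΦ.continuousAt hWmem).congr (Filter.eventuallyEq_of_mem hWmem fun q hq ↦ (heq q hq).symm))

/-- **The deformation of the vector part onto the section at infinity**, a homotopy from the
inclusion `P(λ ⊕ ℂ) ∖ s₀(B) ↪ P(λ ⊕ ℂ)` to `s_∞ ∘ π` (Milnor–Stasheff §9: `E₀` deformation-retracts
away from the zero section; here on the projective completion, `[v : z] ↦ [v : (1 - t) z]`).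
[cite: MilnorStasheff1974, §9] -/
def vectorPartHomotopy :
    ContinuousMap.Homotopy (subsetIncl (vectorPart F E))
      ((complInf F E hF).comp ((complProj F E).comp (subsetIncl (vectorPart F E)))) where
  toFun := vectorPartScaleFun F E
  continuous_toFun := continuous_vectorPartScaleFun F E
  map_zero_left p := by
    obtain ⟨⟨b, ℓ⟩, hp⟩ := p
    change (⟨b, lineScale ((1 - ((0 : I) : ℝ) : ℝ) : ℂ) ℓ⟩ : ProjCompl F E) = ⟨b, ℓ⟩
    rw [show ((1 - ((0 : I) : ℝ) : ℝ) : ℂ) = 1 by norm_num, lineScale_one]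
  map_one_left p := by
    obtain ⟨⟨b, ℓ⟩, hp⟩ := p
    change (⟨b, lineScale ((1 - ((1 : I) : ℝ) : ℝ) : ℂ) ℓ⟩ : ProjCompl F E) = complInf F E hF b
    induction ℓ using Projectivization.ind with
    | h w hw =>
      obtain ⟨v, z⟩ := w
      have hv : v ≠ 0 := (mk_mem_vectorPart_iff b v z hw).1 hp
      rw [show ((1 - ((1 : I) : ℝ) : ℝ) : ℂ) = 0 by norm_num, lineScale_zero_mk hv z hw, complInf_apply]
      congr 1
      exact infPt_eq_infPt (finrank_fibre_eq_one F E hF b) hv _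

omit [TopologicalSpace B] [FiniteDimensional ℂ F] [TopologicalSpace (TotalSpace F E)] [∀ b, TopologicalSpace (E b)]
  [FiberBundle F E] [VectorBundle ℂ F E] in
/-- The scaling stays inside the vector part. [folklore] -/
theorem vectorPartScaleFun_mem (q : I × ↥(vectorPart F E)) : vectorPartScaleFun F E q ∈ vectorPart F E := by
  obtain ⟨t, ⟨⟨b, ℓ⟩, hp⟩⟩ := q
  induction ℓ using Projectivization.ind with
  | h w hw =>
    obtain ⟨v, z⟩ := w
    have hv : v ≠ 0 := (mk_mem_vectorPart_iff b v z hw).1 hp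
    change (⟨b, lineScale _ (Projectivization.mk ℂ (v, z) hw)⟩ : ProjCompl F E) ∈ vectorPart F E
    rw [lineScale_mk _ hv z hw]
    exact (mk_mem_vectorPart_iff b v _ _).2 hv

/-- **The retraction `r = s_∞ ∘ π` of the vector part onto the section at infinity.** [cite: MilnorStasheff1974, §9] -/
def vectorPartRetraction : C(↥(vectorPart F E), ↥(vectorPart F E)) where
  toFun p := ⟨complInf F E hF p.1.proj, complInf_mem_vectorPart F E hF _⟩
  continuous_toFun := ((complInf F E hF).continuous.comp ((complProj F E).continuous.comp continuous_subtype_val)).subtype_mk _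

/-- **`𝟙 ≃ s_∞ ∘ π` INSIDE the vector part** (the scaling deformation, which stays in the vector part).
[cite: MilnorStasheff1974, §9] -/
def vectorPartRetractHomotopy :
    ContinuousMap.Homotopy (ContinuousMap.id ↥(vectorPart F E)) (vectorPartRetraction F E hF) where
  toFun q := ⟨vectorPartScaleFun F E q, vectorPartScaleFun_mem F E q⟩
  continuous_toFun := (continuous_vectorPartScaleFun F E).subtype_mk _
  map_zero_left p := Subtype.ext ((vectorPartHomotopy F E hF).map_zero_left p)
  map_one_left p := Subtype.ext ((vectorPartHomotopy F E hF).map_one_left p)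

include hF in
/-- **Restriction `Hⁿ(P(λ ⊕ ℂ)) → Hⁿ(P(λ ⊕ ℂ) ∖ s₀(B))` is onto**: every class `y` of the vector part
is `(s_∞ ∘ π)^* y = (π^* s_∞'^* y)|`, the vector part retracting onto `s_∞(B)` inside itself.
[cite: MilnorStasheff1974, §9] -/
theorem map_subsetIncl_vectorPart_surjective (R : Type u) [CommRing R] (n : ℕ) :
    Surjective (singularCohomology.map R R (subsetIncl (vectorPart F E)) n) := by
  intro y
  -- `s_∞` with values in the vector part
  set sInf : C(B, ↥(vectorPart F E)) :=
    ⟨fun b ↦ ⟨complInf F E hF b, complInf_mem_vectorPart F E hF b⟩, (complInf F E hF).continuous.subtype_mk _⟩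
    with hsInf
  refine ⟨singularCohomology.map R R (complProj F E) n (singularCohomology.map R R sInf n y), ?_⟩
  have hr : vectorPartRetraction F E hF = sInf.comp ((complProj F E).comp (subsetIncl (vectorPart F E))) := rfl
  have hy : y = singularCohomology.map R R (vectorPartRetraction F E hF) n y := by
    rw [← singularCohomology.map_eq_of_homotopic_holds R R ⟨vectorPartRetractHomotopy F E hF⟩ n,
      singularCohomology.map_id]
    rfl
  rw [← ModuleCat.comp_apply, ← singularCohomology.map_comp, ← ModuleCat.comp_apply, ← singularCohomology.map_comp,
    ← hr, ← hy]

include hF in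
/-- **`Hⁿ⁺¹(P(λ ⊕ ℂ), P(λ ⊕ ℂ) ∖ s₀(B)) → Hⁿ⁺¹(P(λ ⊕ ℂ))` is one-to-one** (the connecting map
`Hⁿ(P ∖ s₀) → Hⁿ⁺¹(P, P ∖ s₀)` vanishes, restriction onto `Hⁿ(P ∖ s₀)` being onto; exactness).
[cite: MilnorStasheff1974, §10 Thm. 10.4] -/
theorem toAbsolute_vectorPart_injective (R : Type u) [CommRing R] (n : ℕ) :
    Injective (relSingularCohomology.toAbsolute R R (ProjCompl F E) (vectorPart F E) (n + 1)) := by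
  refine (injective_iff_map_eq_zero _).2 fun x hx ↦ ?_
  have hex := relSingularCohomology.exact_δ_toAbsolute (R := R) (M := R) (X := ProjCompl F E) (vectorPart F E) n (n + 1) rfl
  rw [ShortComplex.moduleCat_exact_iff] at hex
  obtain ⟨y, rfl⟩ := hex x hx
  obtain ⟨y', rfl⟩ := map_subsetIncl_vectorPart_surjective F E hF R n y
  have h0 : singularCohomology.map R R (subsetIncl (vectorPart F E)) n ≫
      relSingularCohomology.δ R R (ProjCompl F E) (vectorPart F E) n (n + 1) rfl = 0 :=
    (relShortComplex_shortExact R R (vectorPart F E)).comp_δ n (n + 1) rfl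
  change (singularCohomology.map R R (subsetIncl (vectorPart F E)) n ≫
    relSingularCohomology.δ R R (ProjCompl F E) (vectorPart F E) n (n + 1) rfl) y' = 0
  rw [h0]
  rfl

/-- **The Thom class vanishes on the vector part**: `t|_{P(λ ⊕ ℂ) ∖ s₀(B)} = 0`, since the
inclusion is homotopic to `s_∞ ∘ π` and `s_∞^* t = 0` (Milnor–Stasheff §9–§10: the Thom class
lives in `H(E, E₀)`). [cite: MilnorStasheff1974, §10 Thm. 10.4] -/
theorem map_subsetIncl_vectorPart_thomClass [T2Space B] [ParacompactSpace B] (R : Type u) [CommRing R] (m : R) :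
    singularCohomology.map R R (subsetIncl (vectorPart F E)) 2 (thomClass F E hF R m) = 0 := by
  rw [singularCohomology.map_eq_of_homotopic_holds R R ⟨vectorPartHomotopy F E hF⟩ 2,
    singularCohomology.map_comp, ModuleCat.comp_apply, singularCohomology.map_comp, ModuleCat.comp_apply,
    (isThomClass_thomClass F E hF R m).map_complInf, map_zero, map_zero]

/-- **The relative Thom class**: a lift `t̃ ∈ H²(P(λ ⊕ ℂ), P(λ ⊕ ℂ) ∖ s₀(B); R)` of the Thom class
(exactness of `H²(D, D ∖ s₀) → H²(D) → H²(D ∖ s₀)`; Milnor–Stasheff's `u ∈ H(E, E₀)`).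
[cite: MilnorStasheff1974, §10 Thm. 10.4] -/
theorem exists_relThomClass [T2Space B] [ParacompactSpace B] (R : Type u) [CommRing R] (m : R) :
    ∃ u : relSingularCohomology R R (ProjCompl F E) (vectorPart F E) 2,
      relSingularCohomology.toAbsolute R R (ProjCompl F E) (vectorPart F E) 2 u = thomClass F E hF R m := by
  have hex := relSingularCohomology.exact_toAbsolute_map (R := R) (M := R) (vectorPart F E) 2
  rw [ShortComplex.moduleCat_exact_iff] at hex
  exact hex (thomClass F E hF R m) (map_subsetIncl_vectorPart_thomClass F E hF R m)

/-- **The relative Thom class `t̃(m) ∈ H²(P(λ ⊕ ℂ), P(λ ⊕ ℂ) ∖ s₀(B); R)`** (a chosen lift of `t(m)`).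
[cite: MilnorStasheff1974, §10 Thm. 10.4] -/
def relThomClass [T2Space B] [ParacompactSpace B] (R : Type u) [CommRing R] (m : R) :
    relSingularCohomology R R (ProjCompl F E) (vectorPart F E) 2 :=
  (exists_relThomClass F E hF R m).choose

/-- `t̃(m)` lifts `t(m)`. [cite: MilnorStasheff1974, §10 Thm. 10.4] -/
theorem toAbsolute_relThomClass [T2Space B] [ParacompactSpace B] (R : Type u) [CommRing R] (m : R) :
    relSingularCohomology.toAbsolute R R (ProjCompl F E) (vectorPart F E) 2 (relThomClass F E hF R m) =
      thomClass F E hF R m :=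
  (exists_relThomClass F E hF R m).choose_spec

/-- **Uniqueness of the relative Thom class**: the only lift of `t(m)` to `H²(P(λ ⊕ ℂ), P(λ ⊕ ℂ) ∖ s₀(B))`.
[cite: MilnorStasheff1974, §10 Thm. 10.4] -/
theorem eq_relThomClass_of_toAbsolute_eq [T2Space B] [ParacompactSpace B] (R : Type u) [CommRing R] (m : R)
    {u : relSingularCohomology R R (ProjCompl F E) (vectorPart F E) 2}
    (hu : relSingularCohomology.toAbsolute R R (ProjCompl F E) (vectorPart F E) 2 u = thomClass F E hF R m) :
    u = relThomClass F E hF R m :=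
  toAbsolute_vectorPart_injective F E hF R 1 (hu.trans (toAbsolute_relThomClass F E hF R m).symm)

end VectorPart


variable {B : Type u} [TopologicalSpace B] (F : Type u) [NormedAddCommGroup F] [NormedSpace ℂ F] [FiniteDimensional ℂ F]
  (E : B → Type u) [∀ b, AddCommGroup (E b)] [∀ b, Module ℂ (E b)]
  [TopologicalSpace (TotalSpace F E)] [∀ b, TopologicalSpace (E b)] [FiberBundle F E] [VectorBundle ℂ F E]
  (hF : Module.finrank ℂ F = 1)

/-! ### Sections, their projectivisation `ŝ = [s : 1]`, and the deformation `s₀ ≃ ŝ` -/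

section Sections

variable {F E}
variable (s : ∀ b, E b) (hs : Continuous fun b ↦ (⟨b, s b⟩ : TotalSpace F E))

omit [TopologicalSpace B] [NormedAddCommGroup F] [NormedSpace ℂ F] [FiniteDimensional ℂ F] [∀ b, Module ℂ (E b)]
  [TopologicalSpace (TotalSpace F E)] [∀ b, TopologicalSpace (E b)] [FiberBundle F E] [VectorBundle ℂ F E] in
/-- The zero set `Z(s) = {b | s b = 0}` of a section. [folklore] -/
def zeroSet (s : ∀ b, E b) : Set B := {b | s b = 0}

omit [TopologicalSpace B] [NormedAddCommGroup F] [NormedSpace ℂ F] [FiniteDimensional ℂ F] [∀ b, Module ℂ (E b)]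
  [TopologicalSpace (TotalSpace F E)] [∀ b, TopologicalSpace (E b)] [FiberBundle F E] [VectorBundle ℂ F E] in
/-- Membership in the zero set. [folklore] -/
@[simp] theorem mem_zeroSet_iff (s : ∀ b, E b) (b : B) : b ∈ zeroSet s ↔ s b = 0 := Iff.rfl

/-- **The projectivised section `ŝ : B → P(λ ⊕ ℂ)`, `b ↦ ⟨b, [s b : 1]⟩`** (the section `s` followed
by the embedding `E(λ) ⊂ P(λ ⊕ ℂ)`). [cite: MilnorStasheff1974, §9] -/
def projSection : C(B, ProjCompl F E) :=
  ⟨complEmbed F E ∘ fun b ↦ (⟨b, s b⟩ : TotalSpace F E), (continuous_complEmbed F E).comp hs⟩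

/-- `ŝ b = ⟨b, [s b : 1]⟩`. [folklore] -/
theorem projSection_apply (b : B) :
    projSection s hs b = ⟨b, Projectivization.mk ℂ (s b, (1 : ℂ)) (pair_one_ne_zero _)⟩ := rfl

/-- **Off its zeros the projectivised section lies in the vector part.** [folklore] -/
theorem mapsTo_projSection_compl_zeroSet : MapsTo (projSection s hs) (zeroSet s)ᶜ (vectorPart F E) :=
  fun b hb ↦ (complEmbed_mem_vectorPart_iff F E (⟨b, s b⟩ : TotalSpace F E)).2 hb

/-- **The deformation `s₀ ≃ ŝ`**, `(t, b) ↦ ⟨b, [t s b : 1]⟩`. [cite: MilnorStasheff1974, §9] -/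
def projSectionHomotopy : ContinuousMap.Homotopy (complZero F E) (projSection s hs) where
  toFun q := complEmbed F E (⟨q.2, ((q.1 : ℝ) : ℂ) • s q.2⟩ : TotalSpace F E)
  continuous_toFun := (continuous_complEmbed F E).comp ((continuous_totalSpace_smul ℂ F E).comp
    ((Complex.continuous_ofReal.comp (continuous_induced_dom.comp continuous_fst)).prodMk (hs.comp continuous_snd)))
  map_zero_left b := by
    change complEmbed F E (⟨b, ((0 : ℝ) : ℂ) • s b⟩ : TotalSpace F E) = ⟨b, zeroPt (E b)⟩
    rw [Complex.ofReal_zero, zero_smul]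
    rfl
  map_one_left b := by
    change complEmbed F E (⟨b, ((1 : ℝ) : ℂ) • s b⟩ : TotalSpace F E) = projSection s hs b
    rw [Complex.ofReal_one, one_smul]
    rfl

/-- **`e(λ) = ŝ^* t`**: the Euler class is the pull-back of the Thom class along ANY projectivised
section (`ŝ ≃ s₀`). [cite: MilnorStasheff1974, §9] -/
theorem eulerClass_eq_map_projSection [T2Space B] [ParacompactSpace B] (R : Type u) [CommRing R] (m : R) :
    eulerClass F E hF R m = singularCohomology.map R R (projSection s hs) 2 (thomClass F E hF R m) := by
  rw [eulerClass, singularCohomology.map_eq_of_homotopic_holds R R ⟨projSectionHomotopy s hs⟩ 2]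

end Sections

/-! ### The local index of a section at a zero -/

section LocalIndex

variable {F E}
variable (R : Type u) [CommRing R] (m : R) (s : ∀ b, E b) (hs : Continuous fun b ↦ (⟨b, s b⟩ : TotalSpace F E))

omit [TopologicalSpace B] [NormedAddCommGroup F] [NormedSpace ℂ F] [FiniteDimensional ℂ F] [∀ b, Module ℂ (E b)]
  [TopologicalSpace (TotalSpace F E)] [∀ b, TopologicalSpace (E b)] [FiberBundle F E] [VectorBundle ℂ F E] in
/-- **The index domain `U_p = {p} ∪ {s ≠ 0}`** of a zero `p`: the complement of the other zeros (a
neighbourhood of `p` when `p` is an isolated zero). [folklore] -/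
def indexDomain (s : ∀ b, E b) (p : B) : Set B := {b | b = p ∨ s b ≠ 0}

omit [TopologicalSpace B] [NormedAddCommGroup F] [NormedSpace ℂ F] [FiniteDimensional ℂ F] [∀ b, Module ℂ (E b)]
  [TopologicalSpace (TotalSpace F E)] [∀ b, TopologicalSpace (E b)] [FiberBundle F E] [VectorBundle ℂ F E] in
/-- `p ∈ U_p`. [folklore] -/
theorem mem_indexDomain_self (s : ∀ b, E b) (p : B) : p ∈ indexDomain s p := Or.inl rfl

omit [TopologicalSpace B] [NormedAddCommGroup F] [NormedSpace ℂ F] [FiniteDimensional ℂ F] [∀ b, Module ℂ (E b)]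
  [TopologicalSpace (TotalSpace F E)] [∀ b, TopologicalSpace (E b)] [FiberBundle F E] [VectorBundle ℂ F E] in
/-- `U_p` is the complement of the other zeros. [folklore] -/
theorem indexDomain_eq_compl (s : ∀ b, E b) (p : B) : indexDomain s p = (zeroSet s \ {p})ᶜ := by
  ext b
  simp only [indexDomain, mem_setOf_eq, mem_compl_iff, mem_sdiff, mem_zeroSet_iff, mem_singleton_iff, not_and,
    not_not]
  tauto

omit [NormedAddCommGroup F] [NormedSpace ℂ F] [FiniteDimensional ℂ F] [∀ b, Module ℂ (E b)]
  [TopologicalSpace (TotalSpace F E)] [∀ b, TopologicalSpace (E b)] [FiberBundle F E] [VectorBundle ℂ F E] in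
/-- With finitely many zeros every index domain is open. [folklore] -/
theorem isOpen_indexDomain [T1Space B] {s : ∀ b, E b} (hZ : (zeroSet s).Finite) (p : B) : IsOpen (indexDomain s p) := by
  rw [indexDomain_eq_compl]
  exact (hZ.subset sdiff_subset).isClosed.isOpen_compl

/-- **The projectivised section restricted to `U_p` is a map of pairs `(U_p, U_p ∖ p) → (D, D ∖ s₀)`.** [folklore] -/
theorem mapsTo_projSection_indexDomain (p : B) :
    MapsTo ((projSection s hs).comp (subsetIncl (indexDomain s p)))
      ({(⟨p, mem_indexDomain_self s p⟩ : ↥(indexDomain s p))}ᶜ : Set ↥(indexDomain s p)) (vectorPart F E) := by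
  intro b hb
  have hb' : s b.1 ≠ 0 := by
    rcases b.2 with h | h
    · exact absurd (Subtype.ext h) hb
    · exact h
  exact mapsTo_projSection_compl_zeroSet s hs hb'

/-- **The local relative Thom class at `p`**: the pull-back `(ŝ|_{U_p})^* t̃ ∈ H²(U_p, U_p ∖ p; R)` of the
relative Thom class along the projectivised section. [cite: MilnorStasheff1974, §9] -/
def localThomPullback [T2Space B] [ParacompactSpace B] (p : B) :
    relSingularCohomology R R ↥(indexDomain s p) {(⟨p, mem_indexDomain_self s p⟩ : ↥(indexDomain s p))}ᶜ 2 :=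
  relSingularCohomology.map R R ((projSection s hs).comp (subsetIncl (indexDomain s p)))
    (mapsTo_projSection_indexDomain s hs p) 2 (relThomClass F E hF R m)

open Classical in
/-- **The local index `ind_p(s) ∈ R` of the section `s` at `p`** with respect to the `R`-orientation
`μ` of the base: the relative Kronecker pairing of the local relative Thom class `(ŝ|_{U_p})^* t̃`
with the local orientation `μ_p`, excised to the index domain `U_p` (McDuff–Salamon 2017, §2.7 /
Thm. 2.7.5: the zeros of a section "counted with multiplicity"; Bott–Tu Thm. 11.17 "local degree of
the section").  Junk value `0` when `U_p` is not open (i.e. `p` is not an isolated zero).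
[cite: McDuffSalamon2017, Thm. 2.7.5] -/
def localIndex [T2Space B] [ParacompactSpace B] (μ : HomologicalOrientation R B 2) (p : B) : R :=
  if h : IsOpen (indexDomain s p) then
    relKroneckerM R ↥(indexDomain s p) {(⟨p, mem_indexDomain_self s p⟩ : ↥(indexDomain s p))}ᶜ 2
      (localThomPullback hF R m s hs p)
      ((localHomology.openSubsetIso R R h (mem_indexDomain_self s p) 2).inv (μ.localClass p))
  else 0

/-- The local index at an open index domain. [folklore] -/
theorem localIndex_of_isOpen [T2Space B] [ParacompactSpace B] (μ : HomologicalOrientation R B 2) (p : B)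
    (h : IsOpen (indexDomain s p)) :
    localIndex hF R m s hs μ p =
      relKroneckerM R ↥(indexDomain s p) {(⟨p, mem_indexDomain_self s p⟩ : ↥(indexDomain s p))}ᶜ 2
        (localThomPullback hF R m s hs p)
        ((localHomology.openSubsetIso R R h (mem_indexDomain_self s p) 2).inv (μ.localClass p)) := by
  rw [localIndex, dif_pos h]

/-- A projectivised section restricted to an open `V ∋ p` inside the index domain is a map of pairs
`(V, V ∖ p) → (D, D ∖ s₀)`. [folklore] -/
theorem mapsTo_projSection_of_subset {p : B} {V : Set B} (hpV : p ∈ V) (hVU : V ⊆ indexDomain s p) :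
    MapsTo ((projSection s hs).comp (subsetIncl V)) ({(⟨p, hpV⟩ : ↥V)}ᶜ : Set ↥V) (vectorPart F E) := by
  intro b hb
  have hb' : s b.1 ≠ 0 := by
    rcases hVU b.2 with h | h
    · exact absurd (Subtype.ext h) hb
    · exact h
  exact mapsTo_projSection_compl_zeroSet s hs hb'

/-- **The local index is local**: it may be computed on ANY open `V ∋ p` inside the index domain, as the
relative Kronecker pairing of `(ŝ|_V)^* t̃ ∈ H²(V, V ∖ p)` with the local orientation excised to `V`
(excision and naturality of the pairing). [cite: HatcherAT2002, Thm. 2.20; §3.1 p. 201] -/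
theorem localIndex_eq_of_subset [T2Space B] [ParacompactSpace B] (μ : HomologicalOrientation R B 2) (p : B)
    (hU : IsOpen (indexDomain s p)) {V : Set B} (hV : IsOpen V) (hpV : p ∈ V) (hVU : V ⊆ indexDomain s p) :
    localIndex hF R m s hs μ p =
      relKroneckerM R ↥V ({(⟨p, hpV⟩ : ↥V)}ᶜ : Set ↥V) 2
        (relSingularCohomology.map R R ((projSection s hs).comp (subsetIncl V))
          (mapsTo_projSection_of_subset s hs hpV hVU) 2 (relThomClass F E hF R m))
        ((localHomology.openSubsetIso R R hV hpV 2).inv (μ.localClass p)) := by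
  rw [localIndex_of_isOpen hF R m s hs μ p hU]
  -- the inclusion of pairs `i : (V, V ∖ p) → (U_p, U_p ∖ p)`
  set i : C(↥V, ↥(indexDomain s p)) := subsetInclusion hVU with hi
  have himaps : MapsTo i ({(⟨p, hpV⟩ : ↥V)}ᶜ : Set ↥V)
      ({(⟨p, mem_indexDomain_self s p⟩ : ↥(indexDomain s p))}ᶜ : Set ↥(indexDomain s p)) := by
    intro b hb hb'
    apply hb
    rw [mem_singleton_iff] at hb' ⊢
    exact Subtype.ext (congrArg (fun q : ↥(indexDomain s p) ↦ (q : B)) hb')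
  -- homology side: `i_* (μ_p excised to V) = μ_p excised to U_p`
  have hhom : relativeSingularHomology.map R R i himaps 2
      ((localHomology.openSubsetIso R R hV hpV 2).inv (μ.localClass p)) =
        (localHomology.openSubsetIso R R hU (mem_indexDomain_self s p) 2).inv (μ.localClass p) := by
    rw [← Iso.hom_inv_id_apply (localHomology.openSubsetIso R R hU (mem_indexDomain_self s p) 2)
      (relativeSingularHomology.map R R i himaps 2 _)]
    congr 1
    change (relativeSingularHomology.map R R i himaps 2 ≫
      relativeSingularHomology.map R R (subsetIncl (indexDomain s p))
        (localHomology.mapsTo_subsetIncl_compl (mem_indexDomain_self s p)) 2) _ = μ.localClass p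
    rw [← relativeSingularHomology.map_comp]
    exact Iso.inv_hom_id_apply (localHomology.openSubsetIso R R hV hpV 2) (μ.localClass p)
  rw [← hhom, ← relKroneckerM_map, localThomPullback, ← ModuleCat.comp_apply, ← relSingularCohomology.map_comp]
  rfl

end LocalIndex

/-! ### The localisation theorem -/

section Main

variable {F E}
variable (R : Type u) [CommRing R] (m : R) (s : ∀ b, E b) (hs : Continuous fun b ↦ (⟨b, s b⟩ : TotalSpace F E))

/-- **Localisation of the Euler number at the zeros of a section** (McDuff–Salamon 2017, Thm. 2.7.5:
"the first Chern number `c₁(E)` is the number of zeros of a section counted with multiplicities";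
Bott–Tu 1982, Thm. 11.17; Milnor–Stasheff 1974, §9–§12): for a complex line bundle `λ` over a closed
`R`-oriented surface `S` and a continuous section `s` with finitely many zeros,

  `⟨e(λ)(m), [S]_μ⟩ = Σ_{p ∈ Z(s)} ind_p(s)`.

Proof: `e(λ) = ŝ^* t` for the projectivised section `ŝ = [s : 1] ≃ s₀`; `t` lifts to the relative
Thom class `t̃ ∈ H²(D, D ∖ s₀(S))` (the vector part retracts onto `s_∞`, which kills `t`), and `ŝ`
maps `S ∖ Z` into `D ∖ s₀`, so `e(λ) = j^*(ŝ^* t̃)` with `ŝ^* t̃ ∈ H²(S, S ∖ Z)`; hence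
`⟨e(λ), [S]⟩ = ⟨ŝ^* t̃, j_*[S]⟩` and `j_*[S] ∈ H₂(S | Z)` is the sum of the local orientations `μ_p`,
`p ∈ Z`, pushed in from the index domains (Hatcher Lemma 3.27 / Prop. 2.30; the tree's
`eq_sum_of_forall_map_eq_restrictLocal`), each contributing `ind_p(s)` by naturality of the Kronecker
pairing. [cite: McDuffSalamon2017, Thm. 2.7.5] -/
theorem kroneckerPairing_eulerClass_fundamentalClass [T2Space B] [CompactSpace B] [ParacompactSpace B]
    [ChartedSpace (EuclideanSpace ℝ (Fin 2)) B] (hZ : (zeroSet s).Finite) (μ : HomologicalOrientation R B 2) :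
    kroneckerPairing R R B 2 (eulerClass F E hF R m) μ.fundamentalClass =
      ∑ p ∈ hZ.toFinset, localIndex hF R m s hs μ p := by
  classical
  set Z : Set B := zeroSet s with hZdef
  set ŝ : C(B, ProjCompl F E) := projSection s hs with hŝ
  have hmaps : MapsTo ŝ Zᶜ (vectorPart F E) := mapsTo_projSection_compl_zeroSet s hs
  -- `e = j^* (ŝ^* t̃)`
  set x : relSingularCohomology R R B Zᶜ 2 := relSingularCohomology.map R R ŝ hmaps 2 (relThomClass F E hF R m)
    with hx
  have he : eulerClass F E hF R m = relSingularCohomology.toAbsolute R R B Zᶜ 2 x := by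
    rw [eulerClass_eq_map_projSection hF s hs R m, hx, ← ModuleCat.comp_apply,
      relSingularCohomology.map_comp_toAbsolute, ModuleCat.comp_apply, toAbsolute_relThomClass]
  rw [he, kroneckerPairing_toAbsolute]
  change relKroneckerM R B Zᶜ 2 x (singularHomology.toLocalOfSet R R B Z 2 μ.fundamentalClass) = _
  -- `j_*[S] ∈ H₂(S | Z)` is the sum of the local orientations pushed in from the index domains
  haveI : Fintype ↥Z := hZ.fintype
  have hUo : ∀ i : ↥Z, IsOpen (indexDomain s (i : B)) := fun i ↦ isOpen_indexDomain hZ i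
  have hvU : ∀ i : ↥Z, (i : B) ∈ indexDomain s (i : B) := fun i ↦ mem_indexDomain_self s i
  have hsep : ∀ i l : ↥Z, l ≠ i → (l : B) ∉ indexDomain s (i : B) := by
    rintro i l hli (h | h)
    · exact hli (Subtype.ext h)
    · exact h l.2
  have hS : Z = ⋃ i ∈ (Finset.univ : Finset ↥Z), ({(i : B)} : Set B) := by
    ext b
    simp only [mem_iUnion, Finset.mem_univ, mem_singleton_iff, exists_prop, true_and]
    exact ⟨fun hb ↦ ⟨⟨b, hb⟩, rfl⟩, fun ⟨i, hi⟩ ↦ hi ▸ i.2⟩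
  set w : ∀ i : ↥Z, localHomology R R ↥(indexDomain s (i : B)) ⟨(i : B), hvU i⟩ 2 :=
    fun i ↦ (localHomology.openSubsetIso R R (hUo i) (hvU i) 2).inv (μ.localClass (i : B)) with hw
  have hfc : IsFundamentalClass μ μ.fundamentalClass :=
    HomologicalOrientation.isFundamentalClass_fundamentalClass_holds 2 μ
  have hwi : ∀ i : ↥Z, relativeSingularHomology.map R R (subsetIncl (indexDomain s (i : B)))
      (localHomology.mapsTo_subsetIncl_compl (hvU i)) 2 (w i) =
        restrictLocal R R (localHomologyOfSet.singleton_subset_of_eq_biUnion_singleton hS i) 2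
          (singularHomology.toLocalOfSet R R B Z 2 μ.fundamentalClass) := by
    intro i
    rw [singularHomology.restrictLocal_toLocalOfSet]
    change (localHomology.openSubsetIso R R (hUo i) (hvU i) 2).hom (w i) =
      singularHomology.toLocal R R (i : B) 2 μ.fundamentalClass
    rw [hw, Iso.inv_hom_id_apply, hfc (i : B)]
  have hsum := localHomologyOfSet.eq_sum_of_forall_map_eq_restrictLocal (R := R) (M := R)
    Subtype.val_injective hvU hsep hS 2 (singularHomology.toLocalOfSet R R B Z 2 μ.fundamentalClass) w hwi
  rw [hsum, map_sum]
  -- each term is the local index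
  have hterm : ∀ i : ↥Z, relKroneckerM R B Zᶜ 2 x
      (relativeSingularHomology.map R R (subsetIncl (indexDomain s (i : B)))
        (localHomologyOfSet.mapsTo_subsetIncl_compl_of_forall_notMem hS hvU hsep i) 2 (w i)) =
      localIndex hF R m s hs μ (i : B) := by
    intro i
    rw [← relKroneckerM_map, localIndex_of_isOpen hF R m s hs μ (i : B) (hUo i), hx, ← ModuleCat.comp_apply,
      ← relSingularCohomology.map_comp]
    rfl
  rw [Finset.sum_congr rfl fun i _ ↦ hterm i]
  exact (Finset.sum_subtype hZ.toFinset (fun b ↦ hZ.mem_toFinset) fun b ↦ localIndex hF R m s hs μ b).symm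

end Main

end Literature.AlgebraicTopology.CharacteristicClasses
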